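import Mathlib
import Literature.Analysis.FluidPDE.UniversalTotalAnomalousDissipator
import HarnessLib

/-!
# Hess-Childs–Rowan (2025): anomalous total dissipation, anomalous regularization and spatial
intermittency of ONE `L^∞_t C^α_x` field, for all `L²` data (Theorems 1.1, 1.5, 1.7)

Named fact (Literature is sorry-free; users take `(h : HessChildsRowan2025b_thm11_thm15_thm17)` and
project with the theorems of `TotalDissipatorAnomalousRegularizationProofs.lean`).

Source: E. Hess-Childs, K. Rowan, *Turbulent and intermittent phenomena in a universal total anomalous
dissipator*, arXiv:2508.00115v1 (31 Jul 2025), 53 pp. [cite: HessChildsRowan2025b]. Only its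
Corollary 1.2 was typed before (`HessChildsRowan2025_cor12`, `AcceleratingDissipationEnhancement.lean`,
whose module docstring quotes Theorem 1.1). Statements (PDF pages):

* **Theorem 1.1** (Anomalous total dissipation, pp. 1–2): "For all `α ∈ (0,1)`, letting
  `V ∈ L^∞([0,1], C^α(T²))` be the corresponding incompressible velocity field constructed in
  Subsection 2.1, there exists `C(α) > 0` such that for all `κ ∈ (0,1)` and `θ₀ ∈ TV(T²)` such that
  `∫ θ₀(dx) = 0`, if `θ^κ(t,x)` is the solution to (1.1), then
  `‖θ^κ(1,·)‖_{L¹(T²)} ≤ C κ^{(1-α)²/12} ‖θ₀‖_{TV(T²)}`."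
* **Theorem 1.5** (Anomalous regularization, p. 2): "There exists `γ ∈ (0,1/2)` such that for all
  `α ∈ (0,1)`, letting `V ∈ L^∞([0,1], C^α(T²))` be the corresponding incompressible velocity field
  constructed in Subsection 2.1, there exists `C(α) > 0` such that for all `κ ∈ (0,1)` and all
  `θ₀ ∈ L²(T²)` such that `∫ θ₀(x) dx = 0`, if `θ^κ(t,x)` is the solution to (1.1), then
  `‖θ^κ‖_{L²([0,1], H^{(1-α)²γ}(T²))} ≤ C ‖θ₀‖_{L²(T²)}`. In particular, `γ` is given
  (semi-)explicitly in Definition 2.4" [(p. 14): `γ := 1/(8(M+7))`, `M` the Lipschitz-rate constant of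
  the two-cell flow, Thm. 2.3 item 5].
* **Definition 1.6** (p. 3): "For `f : T² → ℝ` with `∫ f(x) dx = 0` and for any `1 ≤ p ≤ ∞`,
  `s ∈ ℝ`, we define the Riesz potential space `H^{s,p}(T²)` by `‖f‖_{H^{s,p}(T²)} := ‖(-Δ)^{s/2} f‖_{L^p(T²)}`
  … We denote `H^s(T²) := H^{s,2}(T²)`."
* **Theorem 1.7** (Intermittent regularity, p. 3): "For all `α ∈ (0,1)`, let `V ∈ L^∞([0,1], C^α(T²))`
  be the corresponding incompressible velocity field constructed in Subsection 2.1, `θ₀ ∈ L²(T²)`,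
  `θ₀ ≠ 0` such that `∫ θ₀(x) dx = 0`, and `θ^κ(t,x)` be the solution to (1.1). Then there exists
  `t_* > 0` depending on `θ₀` such that for all `t ∈ (0,t_*)`, `β ∈ (0,1)`, `p > β⁻¹`,
  `lim_{κ→0} ‖θ^κ(t,·)‖_{H^{β,p}(T²)} = ∞`. In particular, `lim_{κ→0} ‖θ^κ‖_{L²([0,1], H^{β,p}(T²))} = ∞`.
  Additionally, if `∫_{{(x,y) ∈ T² : x < √2/2}} θ₀(x,y) dx dy ≠ 0`, then `t_*` can be taken to be
  `1 - σ₀/2`, with `σ₀` defined in Definition 2.4."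
* The field: Def. 2.1 (p. 12: "`B := [0,√2] × [0,1]` … and throughout we identify `T²` as `B` with
  periodic boundaries"), Def. 2.4–2.5 (p. 14: singular times `sⁱⱼ`, `V(t,x) := σⱼ⁻¹ Rʲ v(σⱼ⁻¹(t - sⁱ_{j+1}), R⁻ʲ x)`
  on `[sⁱ_{j+1}, sⁱⱼ)`, `0` on `[s^{i+1}_{i+1}, sⁱ_∞]`, (2.4)), **Lemma 2.6** (p. 14): "For `V` defined by
  (2.4), `V ∈ L^∞([0,1], C^α(T²))`." — "divergence-free"/"incompressible" throughout.

## Rendering (identical to `HessChildsRowan2025_cor12` and `UniversalTotalAnomalousDissipator.lean`)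

The flat torus `ℝ²/(√2ℤ ⊕ ℤ)` with the isotropic `κΔ` is written on the unit torus
`UnitAddTorus (Fin 2)` in the coordinates `(x₀,x₁) ↦ (√2 x₀, x₁)`, where the equation is the weak
class `Torus.IsWeakScalarTransportDiagOn 1 ![2⁻¹, 1] κ V θ₀ θ` (solutions on `T² × [0,1)`,
`θ ∈ L^∞_t L²_x`); "the solution `θ^κ`" (unique for `κ > 0`, bounded divergence-free drift, `L²`
datum; it lies in `C([0,1]; L²)`) = every weak solution, and where a time slice is evaluated
(Thm. 1.1 at `t = 1`, Thm. 1.7 at `t ∈ (0,t_*)`) every weak solution that is the `L²`-continuous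
representative on `[0,1]` (`Torus.IsL2ContinuousOn (Icc 0 1) θ`). The field is packaged
existentially with the printed properties (`HessChildsRowan2025b.IsCarrier`: space–time measurable,
bounded, `α`-Hölder in space with one constant at every time, weakly divergence free at every time),
ONE field carrying all three theorems ("the corresponding velocity field constructed in
Subsection 2.1" in each). Sobolev scale: Def. 1.6's `H^s = H^{s,2}` is the HOMOGENEOUS (Riesz
potential) scale on mean-zero functions, rendered by the tree's spectral
`Torus.eHomSobolevSeminorm s` (weights `|k|^s`, `k ∈ ℤ² ∖ {0}`) of the complexified slice; the
flat-torus symbol `(4π²(k₀²/2 + k₁²))^{s/2}` and `|k|^s` differ by factors in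
`[(2π²)^{s/2}, (4π²)^{s/2}]`, bounded for the bounded exponents at hand — absorbed in the
unspecified constants `C(α)` (Thm. 1.5) and irrelevant for divergence to `∞` (Thm. 1.7).
`L²_t` norms are written as `∫⁻ t ∈ (0,1), ‖θ(t)‖²_{Ḣ^s} dt` (squared form).

## Recorded weakenings / readings (never a strengthening)

1. Thm. 1.1 DATA CLASS: printed for mean-zero measures `θ₀ ∈ TV(T²)`; typed for mean-zero
   `θ₀ ∈ L²(T²) ⊆ TV` with `‖θ₀‖_{TV} = ‖θ₀‖_{L¹}` (the tree's weak class carries `L²` data), as in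
   `HessChildsRowan2025a.DissipatesTotally`. Thms. 1.5, 1.7 are printed for `L²` data: no weakening.
2. Thm. 1.7 INTEGRABILITY EXPONENT: printed for all `p > β⁻¹` in the Riesz potential scale
   `H^{β,p} = (-Δ)^{-β/2} L^p`; the tree has no `L^p`-based fractional scale for `p ≠ 2` on rough
   functions, so the typed clause is the case `p = 2`, i.e. `β ∈ (1/2, 1)`:
   `lim_{κ→0} ‖θ^κ(t)‖_{Ḣ^β} = ∞` and `lim_{κ→0} ‖θ^κ‖_{L²_t Ḣ^β_x} = ∞`. WEAKER (a special case);
   the `p ≠ 2` cases are quoted above, not typed. The refinement "`t_*` can be taken to be `1 - σ₀/2`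
   if `∫_{x<√2/2} θ₀ ≠ 0`" is quoted, not typed (it needs the explicit `σ₀ = 1/Z` of Def. 2.4).
   `t_*` is typed in `(0,1]` (the solutions live on `[0,1]`; `min(t_*,1)` serves).
3. "`lim_{κ→0} … = ∞`" is typed as: for every `M` there is `κ₀ ∈ (0,1]` such that for all
   `κ ∈ (0,κ₀)` and every (`L²`-continuous) weak solution the norm is `≥ M` — the definition of the
   limit over the standing range `κ ∈ (0,1)` of the paper, solutions being unique.
4. `γ` is typed existentially in `(0,1/2)` BEFORE `α` (as printed); its semi-explicit value
   `1/(8(M+7))` depends on the unprinted constant `M` of Thm. 2.3.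

## Not typed here (with reasons)

* Thm. 1.4 / Cor. 1.8 / Prop. 1.9 (Richardson dispersion: variance of the SDE (1.2)) — stochastic
  trajectories; the tree's scalar vocabulary is Eulerian. Harvested in the cell notes.
* Prop. 1.10 (Aubin–Lions criterion: a discontinuous limiting energy profile forces
  `‖θ^{κⱼ}‖_{L^∞_t H^s_x} → ∞`), Thm. 1.11 (= [DRDII25, Cor. 5.4], Besov classes), Thm. 1.12
  (its sharpness for `p = ∞`, `γ = 2`; Besov classes `B^{σ,∞}_∞`, `B^{β,q}_∞`) — separate stories
  (general criteria / a different source); Thm. 2.3, Thm. 2.10, Cor. 2.11, §§3–6: construction-internal.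
* Open questions printed in §1.2 (p. 11) — (i) anomalous dissipation / Richardson dispersion for
  "generic fluid-like models"; (ii) a (more) time-homogeneous field with dispersion and
  regularization from arbitrary initial times; (iii) sharp anomalous regularization up to
  `L²([0,1], H^{(1-α)/2 -})` ("the construction and argument of [AV25] is a likely candidate");
  (iv) intermittency for realistic models — and (1.4) p. 5 (maximal asymptotic decay rate for
  regular flows) are OPEN; recorded, not typed (conjectures are not Literature).
-/

noncomputable section

namespace Literature.Analysis.FluidPDE

open _root_.MeasureTheory _root_.Set _root_.Filter
open scoped NNReal ENNReal Topology

namespace HessChildsRowan2025b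

/-- **The carrier class of Theorem 1.1 / Lemma 2.6** on the unit torus (module docstring,
*Rendering*): `V : ℝ → T² → ℝ²` space–time measurable, bounded by `A`, `α`-Hölder in space with
constant `A` at every time ("`V ∈ L^∞([0,1], C^α(T²))`", Lemma 2.6 p. 14) and weakly divergence free
at every time ("divergence-free vector field", (2.4)). No time regularity is printed for this field
(contrast `HessChildsRowan2025a.IsCarrier`); a representative defined for every `t ∈ ℝ` changes
nothing for weak solutions on `[0,1)`. [cite: HessChildsRowan2025b, Def. 2.5 (2.4) and Lemma 2.6, p. 14; Thm. 1.1 p. 1] -/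
def IsCarrier (α : ℝ≥0) (V : ℝ → UnitAddTorus (Fin 2) → EuclideanSpace ℝ (Fin 2)) : Prop :=
  AEStronglyMeasurable (FunctionSpaces.Torus.stLift V) volume ∧
  (∃ A : ℝ≥0, (∀ (t : ℝ) (x : UnitAddTorus (Fin 2)), ‖V t x‖ ≤ A) ∧
    ∀ t : ℝ, HolderWith A α (V t)) ∧
  ∀ t : ℝ, FunctionSpaces.Torus.IsWeaklyDivFree (V t)

/-- **The estimate of Theorem 1.1 (anomalous total dissipation, rate `κ^{(1-α)²/12}`)** for a field
`V` on the unit torus with the diffusion `κ (½ ∂₀∂₀ + ∂₁∂₁)`: there is `C > 0` such that for all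
`κ ∈ (0,1)`, all mean-zero `θ₀ ∈ L²(T²)` and every weak solution of
`∂ₜθ + V·∇θ = κ (½ ∂₀∂₀ + ∂₁∂₁) θ`, `θ(0) = θ₀` on `T² × [0,1)` which is the `L²`-continuous
representative on `[0,1]`, `‖θ(1)‖_{L¹(T²)} ≤ C κ^{(1-α)²/12} ‖θ₀‖_{L¹(T²)}` (printed for
mean-zero `θ₀ ∈ TV(T²)` with `‖θ₀‖_{TV}`; data class `L²`, recorded weakening 1). Same shape as
`HessChildsRowan2025a.DissipatesTotally` (there: all `κ > 0`, exponent `/72`). [cite: HessChildsRowan2025b, Thm. 1.1, pp. 1–2] -/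
def DissipatesTotally (α : ℝ≥0) (V : ℝ → UnitAddTorus (Fin 2) → EuclideanSpace ℝ (Fin 2)) : Prop :=
  ∃ C : ℝ, 0 < C ∧ ∀ κ : ℝ, 0 < κ → κ < 1 →
    ∀ θ₀ : UnitAddTorus (Fin 2) → ℝ, MemLp θ₀ 2 volume → ∫ x, θ₀ x = 0 →
      ∀ θ : ℝ → UnitAddTorus (Fin 2) → ℝ,
        Torus.IsWeakScalarTransportDiagOn 1 ![2⁻¹, 1] κ V θ₀ θ →
        Torus.IsL2ContinuousOn (Icc 0 1) θ →
          eLpNorm (θ 1) 1 volume ≤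
            ENNReal.ofReal (C * κ ^ ((1 - (α : ℝ)) ^ 2 / 12)) * eLpNorm θ₀ 1 volume

/-- **The estimate of Theorem 1.5 (anomalous regularization)** with exponent parameter `γ`, for a
field `V` on the unit torus with the diffusion `κ (½ ∂₀∂₀ + ∂₁∂₁)`: there is `C > 0` such that for
all `κ ∈ (0,1)`, all mean-zero `θ₀ ∈ L²(T²)` and every weak solution `θ` on `T² × [0,1)`,
`∫₀¹ ‖θ(t)‖²_{Ḣ^{(1-α)²γ}} dt ≤ C² ‖θ₀‖²_{L²}` — printed `‖θ^κ‖_{L²([0,1],H^{(1-α)²γ}(T²))} ≤ C‖θ₀‖_{L²(T²)}`,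
`H^s` the Riesz-potential (homogeneous) scale of Def. 1.6, rendered by
`Torus.eHomSobolevSeminorm` of the complexified slices (normalisation absorbed in `C`, module
docstring *Rendering*). Uniform in `κ`: the scalar gains `(1-α)²γ` derivatives over `L²` data,
independently of the diffusivity. [cite: HessChildsRowan2025b, Thm. 1.5 p. 2; Def. 1.6 p. 3; Def. 2.4 p. 14 (γ)] -/
def RegularizesAnomalously (γ : ℝ) (α : ℝ≥0)
    (V : ℝ → UnitAddTorus (Fin 2) → EuclideanSpace ℝ (Fin 2)) : Prop :=
  ∃ C : ℝ, 0 < C ∧ ∀ κ : ℝ, 0 < κ → κ < 1 →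
    ∀ θ₀ : UnitAddTorus (Fin 2) → ℝ, MemLp θ₀ 2 volume → ∫ x, θ₀ x = 0 →
      ∀ θ : ℝ → UnitAddTorus (Fin 2) → ℝ,
        Torus.IsWeakScalarTransportDiagOn 1 ![2⁻¹, 1] κ V θ₀ θ →
          ∫⁻ t in Ioo (0 : ℝ) 1,
              FunctionSpaces.Torus.eHomSobolevSeminorm ((1 - (α : ℝ)) ^ 2 * γ)
                (fun x => (θ t x : ℂ)) ^ 2 ≤
            ENNReal.ofReal (C ^ 2) * ∫⁻ x, ‖θ₀ x‖ₑ ^ 2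

/-- **The conclusion of Theorem 1.7 (intermittent regularity), case `p = 2`**, for a field `V` on
the unit torus with the diffusion `κ (½ ∂₀∂₀ + ∂₁∂₁)`: for every NONZERO mean-zero `θ₀ ∈ L²(T²)`
there is `t_* ∈ (0,1]` (depending on `θ₀`) such that for all `t ∈ (0,t_*)` and all `β ∈ (1/2,1)`
(printed: `β ∈ (0,1)`, `p > β⁻¹`; here `p = 2`, recorded weakening 2):
`lim_{κ→0} ‖θ^κ(t)‖_{Ḣ^β} = ∞` and `lim_{κ→0} ‖θ^κ‖_{L²([0,1],Ḣ^β)} = ∞`, i.e. for every `M` there is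
`κ₀ ∈ (0,1]` such that for all `κ ∈ (0,κ₀)` and every weak solution `θ` on `T² × [0,1)` which is the
`L²`-continuous representative on `[0,1]`, `M ≤ ‖θ(t)‖_{Ḣ^β}` and `M ≤ (∫₀¹ ‖θ(s)‖²_{Ḣ^β} ds)^{1/2}`
(recorded reading 3). Even smooth data "immediately develops intermittent spatial regularity"
(p. 8), while Thm. 1.5 bounds `‖θ^κ‖_{L²_t H^{(1-α)²γ}}` uniformly. [cite: HessChildsRowan2025b, Thm. 1.7 p. 3; Def. 1.6 p. 3] -/
def IsSpatiallyIntermittent (V : ℝ → UnitAddTorus (Fin 2) → EuclideanSpace ℝ (Fin 2)) : Prop :=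
  ∀ θ₀ : UnitAddTorus (Fin 2) → ℝ, MemLp θ₀ 2 volume → ∫ x, θ₀ x = 0 → ¬ θ₀ =ᵐ[volume] 0 →
    ∃ tStar : ℝ, 0 < tStar ∧ tStar ≤ 1 ∧ ∀ t ∈ Ioo 0 tStar, ∀ β : ℝ, 1 / 2 < β → β < 1 →
      ∀ M : ℝ≥0, ∃ κ₀ : ℝ, 0 < κ₀ ∧ κ₀ ≤ 1 ∧ ∀ κ ∈ Ioo 0 κ₀,
        ∀ θ : ℝ → UnitAddTorus (Fin 2) → ℝ,
          Torus.IsWeakScalarTransportDiagOn 1 ![2⁻¹, 1] κ V θ₀ θ →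
          Torus.IsL2ContinuousOn (Icc 0 1) θ →
            (M : ℝ≥0∞) ≤ FunctionSpaces.Torus.eHomSobolevSeminorm β (fun x => (θ t x : ℂ)) ∧
            (M : ℝ≥0∞) ≤
              (∫⁻ s in Ioo (0 : ℝ) 1,
                  FunctionSpaces.Torus.eHomSobolevSeminorm β (fun x => (θ s x : ℂ)) ^ 2) ^ (1 / 2 : ℝ)

end HessChildsRowan2025b

/-- **Hess-Childs–Rowan 2025 (arXiv:2508.00115), Theorems 1.1, 1.5 and 1.7 for ONE field**, as printed
on the flat torus `T² = [0,√2] × [0,1]` (Def. 2.1) with the isotropic `κΔ`, written on the unit torus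
where `κΔ` becomes `κ (½ ∂₀∂₀ + ∂₁∂₁)` (module docstring, *Rendering*): there is `γ ∈ (0,1/2)` such
that for every `α ∈ (0,1)` there is a divergence-free field `V ∈ L^∞([0,1], C^α(T²))`
(`HessChildsRowan2025b.IsCarrier α V`; "the corresponding incompressible velocity field constructed in
Subsection 2.1", the same in all three theorems) with
* Thm. 1.1 — `HessChildsRowan2025b.DissipatesTotally α V`: ONE `C(α)` with
  `‖θ^κ(1)‖_{L¹} ≤ C κ^{(1-α)²/12} ‖θ₀‖_{L¹}` for all `κ ∈ (0,1)` and all mean-zero `L²` data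
  (recorded weakening 1: printed for `TV` data);
* Thm. 1.5 — `HessChildsRowan2025b.RegularizesAnomalously γ α V`:
  `‖θ^κ‖_{L²([0,1],Ḣ^{(1-α)²γ})} ≤ C ‖θ₀‖_{L²}` uniformly in `κ ∈ (0,1)`, all mean-zero `L²` data;
* Thm. 1.7 (case `p = 2`) — `HessChildsRowan2025b.IsSpatiallyIntermittent V`: for every nonzero
  mean-zero `L²` datum, `‖θ^κ(t)‖_{Ḣ^β} → ∞` and `‖θ^κ‖_{L²_t Ḣ^β_x} → ∞` as `κ → 0`, for all
  `t ∈ (0,t_*)`, `β ∈ (1/2,1)` (recorded weakening 2: printed for all `p > β⁻¹` in `H^{β,p}`).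
The three printed theorems are its projections (`HessChildsRowan2025b_thm11/_thm15/_thm17` in
`TotalDissipatorAnomalousRegularizationProofs.lean`); Cor. 1.2 of the same paper is
`HessChildsRowan2025_cor12`. [cite: HessChildsRowan2025b, Thm. 1.1 pp. 1–2; Thm. 1.5 p. 2; Thm. 1.7 p. 3; Def. 1.6 p. 3; Def. 2.1 p. 12; Def. 2.4–2.5, Lemma 2.6 p. 14] -/
def HessChildsRowan2025b_thm11_thm15_thm17 : Prop :=
  ∃ γ : ℝ, 0 < γ ∧ γ < 1 / 2 ∧ ∀ α : ℝ≥0, 0 < α → α < 1 →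
    ∃ V : ℝ → UnitAddTorus (Fin 2) → EuclideanSpace ℝ (Fin 2),
      HessChildsRowan2025b.IsCarrier α V ∧ HessChildsRowan2025b.DissipatesTotally α V ∧
        HessChildsRowan2025b.RegularizesAnomalously γ α V ∧
        HessChildsRowan2025b.IsSpatiallyIntermittent V

end Literature.Analysis.FluidPDE

end
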